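import Summits.ABC.ABC.Theses.CuspFieldPencil
import Literature.Barriers.ABC.BakerMethodBounds

/-! Sketch (planner, stub-ideation k3 **g2**): Lean-typed statements for the EXTREMAL / REGIME audit of
`stub_conjugateCuspTriple` (crux stmt-ABC-26026 `GoldenCuspShadow`). Statements only; `sorry` bodies.
G0 = the ℚ-line statement `UWMinP` (k2 Plan B, P-form); G1 = it gives the CRUX outright; G2/G3 = it gives THIS STUB on the
regime `min(rad u, rad w) ≤ rad(Q)²`; G4 = `P(n) ≤ rad(n)`; G5 = the degenerate (Ξ = 1) points of the two auxiliary identities. -/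

set_option linter.dupNamespace false

namespace Summit.ABC.ABC.Cruxes.GoldenCuspShadow.ConjugateK3G2

open UniqueFactorizationMonoid Literature.Barriers.ABC
open Summit.ABC.ABC.Theses.CuspFieldPencil

/-- The registered stub signature, verbatim (payload.stub.signature). -/
def SigStubConjugateCuspTriple : Prop :=
  ∀ ε : ℝ, 0 < ε → ∃ κ : ℝ, ∀ u w : ℤ, IsCoprime u w → u * w * (u ^ 2 - 11 * u * w - w ^ 2) ≠ 0 → Real.log (max (|(u : ℝ)|) (|(w : ℝ)|)) ≤ κ * (((UniqueFactorizationMonoid.radical (u * w * (u ^ 2 - 11 * u * w - w ^ 2))).natAbs : ℕ) : ℝ) ^ (ε : ℝ) * ((((UniqueFactorizationMonoid.radical (u ^ 2 - 11 * u * w - w ^ 2)).natAbs : ℕ) : ℝ) ^ (2 / 3 : ℝ) * (min (((UniqueFactorizationMonoid.radical u).natAbs : ℕ) : ℝ) (((UniqueFactorizationMonoid.radical w).natAbs : ℕ) : ℝ)) ^ (2 / 3 : ℝ))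

/-- The stub inequality RESTRICTED to the regime `min(rad u, rad w) ≤ rad(Q)²` (where the ℚ-line dominates it). -/
def SigStubOnDominatedRegime : Prop :=
  ∀ ε : ℝ, 0 < ε → ∃ κ : ℝ, ∀ u w : ℤ, IsCoprime u w → u * w * (u ^ 2 - 11 * u * w - w ^ 2) ≠ 0 →
    min (radical u).natAbs (radical w).natAbs ≤ (radical (u ^ 2 - 11 * u * w - w ^ 2)).natAbs ^ 2 →
    Real.log (max (|(u : ℝ)|) (|(w : ℝ)|)) ≤ κ * (((radical (u * w * (u ^ 2 - 11 * u * w - w ^ 2))).natAbs : ℕ) : ℝ) ^ (ε : ℝ) * ((((radical (u ^ 2 - 11 * u * w - w ^ 2)).natAbs : ℕ) : ℝ) ^ (2 / 3 : ℝ) * (min (((radical u).natAbs : ℕ) : ℝ) (((radical w).natAbs : ℕ) : ℝ)) ^ (2 / 3 : ℝ))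

/-! ### G0 the ℚ-line statement (k2 Plan B in P-form): `log H ≤ κ_ε · R^ε · min(P(u), P(w))`, `P(1) = 1`
(`Literature.Barriers.ABC.largestPrimeFactor`). Source of (A)/(B): tree-proved place bounds
`Summit.ABC.StewartYu.KummerThird.placeBound_a_of_y07At / placeBound_c_of_y07At` on the auxiliary triples
`Q + w² = u(u − 11w)`, `u² − Q = w(11u + w)` (equivalently the p-adic half of `Pasten.approx_div`); of (C): the archimedean
half of `Pasten.approx_div` with `Summit.ABC.ABC.Theorems.approximationBound_rat_holds` (KERNEL THEOREM, ✓ p584875, 2026-08-27) —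
every input is a tree theorem, so `UWMinP` (hence, by G1, the crux) is UNCONDITIONAL; see k2 gen-2 Plan A for the prover-sized cut. -/
def UWMinP : Prop :=
  ∀ ε : ℝ, 0 < ε → ∃ κ : ℝ, ∀ u w : ℤ, IsCoprime u w → u * w * (u ^ 2 - 11 * u * w - w ^ 2) ≠ 0 →
    Real.log (max (|(u : ℝ)|) (|(w : ℝ)|)) ≤
      κ * (((radical (u * w * (u ^ 2 - 11 * u * w - w ^ 2))).natAbs : ℕ) : ℝ) ^ (ε : ℝ) *
        (min (largestPrimeFactor u.natAbs) (largestPrimeFactor w.natAbs) : ℕ)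

/-- G4 (XS): `P(n) ≤ rad(n)` for `n ≠ 0` (`largestPrimeFactor n = max 1 (n.primeFactors.sup id)`,
`Nat.radical_eq_prod_primeFactors`, `Int.radical_natAbs_eq_radical`). -/
theorem largestPrimeFactor_le_natAbs_radical (n : ℤ) (hn : n ≠ 0) :
    largestPrimeFactor n.natAbs ≤ (radical n).natAbs := by
  sorry

/-- G1 (S): the ℚ-line statement gives the CRUX outright — `min(P u, P w) ≤ (rad u · rad w)^{1/2} ≤ R^{1/2}`
(G4 + `natAbs_radical_prod`), `R^ε · R^{1/2} = R^{1/2+ε}` (`Real.rpow_add`). For the lead: the stub is BYPASSABLE and the crux unconditional over ℚ. -/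
theorem goldenCuspShadow_of_uwMinP (h : UWMinP) : GoldenCuspShadow := by
  sorry

/-- G3 (XS, real arithmetic of the regime): `1 ≤ m ≤ q²` ⇒ `m ≤ q^{2/3} · m^{2/3}` (`m = m^{1/3} m^{2/3}`, `m^{1/3} ≤ (q²)^{1/3}`). -/
theorem rpow_regime_glue {m q : ℝ} (hm : 1 ≤ m) (hq : 0 ≤ q) (h : m ≤ q ^ 2) :
    m ≤ q ^ (2 / 3 : ℝ) * m ^ (2 / 3 : ℝ) := by
  sorry

/-- G2 (S): on the regime `min(rad u, rad w) ≤ rad(Q)²` the ℚ-line statement implies THIS STUB's inequality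
(`min P ≤ min rad = m`, G4; then G3 with `q = rad Q`). Census (400-half-box, H > 1): the regime holds for 194702 / 194708 coprime pairs. -/
theorem stubOnDominatedRegime_of_uwMinP (h : UWMinP) : SigStubOnDominatedRegime := by
  sorry

/-- G5 (XS, the degenerate points of the two auxiliary identities used by (A)/(C): `Ξ = 1`):
for coprime `u, w` with `uwQ ≠ 0`, `u(u − 11w) = 0 ∨ w(11u + w) = 0` iff `(u, w) = ±(11, 1)` or `±(1, −11)` (all four are
unit points `Q = ∓1`; finitely many, absorbed in `κ`). -/
theorem aux_degenerate_iff (u w : ℤ) (hcop : IsCoprime u w) (h0 : u * w * (u ^ 2 - 11 * u * w - w ^ 2) ≠ 0) :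
    (u * (u - 11 * w) = 0 ∨ w * (11 * u + w) = 0) ↔
      ((u = 11 ∧ w = 1) ∨ (u = -11 ∧ w = -1) ∨ (u = 1 ∧ w = -11) ∨ (u = -1 ∧ w = 11)) := by
  sorry

/-- G6 (XS, 5-adic shape of the cusp norm form, for the constant bookkeeping `N(5√5) = 125` of Plan 1 and the gcd's of
(A)/(C)): for coprime `u, w`, `5 ∣ Q` iff `u ≡ 3w (mod 5)`, and then `v₅(Q) ∈ {2, 3}`; in particular `5⁴ ∤ Q`. -/
theorem five_pow_four_not_dvd_Q (u w : ℤ) (hcop : IsCoprime u w) :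
    ¬ ((5 : ℤ) ^ 4 ∣ u ^ 2 - 11 * u * w - w ^ 2) := by
  sorry

end Summit.ABC.ABC.Cruxes.GoldenCuspShadow.ConjugateK3G2
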